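import Summits.QuantumFields.QCD.Theorems.PauliWegnerSeaFMClosureUnquenchedRepairedC2

/-!
# Crux `FMClosureUnquenched` (stmt-QuantumFields-11512), line `von-mises-circles`, lead c2:
the global a-priori bound on the crux's moment (the honest INWARD statement)

Companion of `Theorems/PauliWegnerSeaFMClosureUnquenchedRepairedC2.lean`.  Clause (ii) of `MobilityGap` asked INSIDE the
input shell (corner A6 of the crux as typed) has no decay mechanism; what IS true there, from K1♭ alone (clause (T5) of the
two-star package, the flavour reduction `c1_cruxMoment_eq_pqE`, and the hopping window for probe masses outside `[-9, 1]`),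
is a bound uniform in the volume, the background data, the masses and the sites, polynomial in the coupling:

* `cruxMoment_apriori_of_localCofactorDomination : LocalCofactorDomination → ∀ N_f, ∃ s C p, 0 < s < 1 ∧ 0 ≤ C ∧
  ∀ β mq S f v, v ∈ box S → cruxMoment N_f β mq S f v s ≤ C (1 + |β|)^p`.

Together with the outward decay of the companion file this is the complete honest replacement of clause (ii): exponential
decay at rate `δ a_k` outside the window `K (1 + |log a_k|) ≤ a_k ‖v‖`, and `O((1 + |β_k|)^p)` everywhere.

References: Aizenman–Schenker–Friedrich–Hundertmark, CMP 224 (2001) 219, Lemma 4 (a-priori bound) [AizenmanEtAl2001].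
-/

noncomputable section

open scoped BigOperators
open MeasureTheory Filter
open Literature.MathematicalPhysics.QuantumFieldTheory Literature.MathematicalPhysics.QuantumLattice
  Literature.Probability.LatticeModels
open Summit.QuantumFields.QCD.Theorems.VonMisesCircles
open Summit.QuantumFields.QCD.Theorems.VonMisesCirclesC1

namespace Summit.QuantumFields.QCD.Theorems.VonMisesCirclesC2

/-- **Global a-priori bound on the crux's moment from K1♭**: for every flavour number there are `0 < s < 1`, `C ≥ 0`
and `p` such that for every coupling `β`, every mass tuple, every volume, every flavour and every `v ∈ box S`,
`cruxMoment N_f β mq S f v s ≤ C (1 + |β|)^p` — clause (T5) of the two-star package for probe masses in `[-9, 1]`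
(after the flavour reduction), the hopping decay outside. [cite: AizenmanEtAl2001, Lemma 4] -/
theorem cruxMoment_apriori_of_localCofactorDomination (hK : LocalCofactorDomination) (Nf : ℕ) :
    ∃ s C p : ℝ, 0 < s ∧ s < 1 ∧ 0 ≤ C ∧
      ∀ (β : ℝ) (mq : Fin Nf → ℝ) (S : ℕ) (f : Fin Nf) (v : Literature.Probability.LatticeModels.Site 4),
        v ∈ box 4 S → cruxMoment Nf β mq S f v s ≤ C * (1 + |β|) ^ p := by
  obtain ⟨s₀, C, p, hs₀, _hs₀1, hC, hT⟩ := twoStarBounds_of_localCofactorDomination hK Nf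
  obtain ⟨CH, μ, hCH, hμ, hH⟩ := hoppingDecay_holds Nf
  set s : ℝ := min s₀ (1 / 2) with hs
  have hs0 : 0 < s := lt_min hs₀ (by norm_num)
  have hss₀ : s ≤ s₀ := min_le_left _ _
  have hs1 : s < 1 := (min_le_right _ _).trans_lt (by norm_num)
  refine ⟨s, max C CH, max p 0, hs0, hs1, hC.le.trans (le_max_left _ _), ?_⟩
  intro β mq S f v hv
  have hβ1 : (1 : ℝ) ≤ 1 + |β| := by have := abs_nonneg β; linarith
  have hpow1 : (1 : ℝ) ≤ (1 + |β|) ^ (max p 0) := Real.one_le_rpow hβ1 (le_max_right _ _)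
  have hmax0 : 0 ≤ max C CH := hC.le.trans (le_max_left _ _)
  by_cases hm : -9 ≤ mq f ∧ mq f ≤ 1
  · -- probe mass in `[-9, 1]`: clause (T5) after the flavour reduction
    obtain ⟨-, -, -, hT5, -, -⟩ := hT s hs0 hss₀ β mq f hm.1 hm.2 S
    have h := hT5 (Torus.proj (2 * S + 1) 0) (Torus.proj (2 * S + 1) v)
    rw [← c1_cruxMoment_eq_pqE] at h
    calc cruxMoment Nf β mq S f v s ≤ C * (1 + |β|) ^ p := h
      _ ≤ max C CH * (1 + |β|) ^ (max p 0) :=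
          mul_le_mul (le_max_left _ _) (Real.rpow_le_rpow_of_exponent_le hβ1 (le_max_left _ _))
            (Real.rpow_nonneg (by linarith) _) hmax0
  · -- probe mass outside `[-9, 1]`: the hopping window
    have hhop : (41 / 10 : ℝ) ≤ |mq f + 4| := by
      rcases not_and_or.1 hm with h | h
      · push Not at h
        rw [abs_of_neg (by linarith)]
        linarith
      · push Not at h
        rw [abs_of_pos (by linarith)]
        linarith
    have h := hH β mq f hhop S s hs0 hs1 v hv
    change cruxMoment Nf β mq S f v s ≤ CH * Real.exp (-(μ * s * ‖v‖)) at h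
    have hexp : Real.exp (-(μ * s * ‖v‖)) ≤ 1 := by
      rw [Real.exp_le_one_iff, neg_nonpos]
      exact mul_nonneg (mul_nonneg hμ.le hs0.le) (norm_nonneg _)
    calc cruxMoment Nf β mq S f v s ≤ CH * Real.exp (-(μ * s * ‖v‖)) := h
      _ ≤ CH * 1 := mul_le_mul_of_nonneg_left hexp hCH
      _ ≤ max C CH * (1 + |β|) ^ (max p 0) := by
          rw [mul_one]
          exact (le_max_right C CH).trans (le_mul_of_one_le_right hmax0 hpow1)

/-- **The honest inward statement for a regularisation**: under K1♭, for every `N_f`, regularisation and mass tuple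
there are `0 < s < 1`, `C`, `p` with `cruxMoment ≤ C (1 + |β_k|)^p` for ALL `k`, all `S`, all flavours and all
`v ∈ box S` (in particular inside the input shell, where the crux as typed asked for decay). [cite: AizenmanEtAl2001, Lemma 4] -/
theorem cruxMoment_apriori_reg (hK : LocalCofactorDomination) {Nf : ℕ} (reg : QCDRegularisation Nf)
    (m : Fin Nf → ℝ) :
    ∃ s C p : ℝ, 0 < s ∧ s < 1 ∧ 0 ≤ C ∧ ∀ (k S : ℕ) (f : Fin Nf) (v : Literature.Probability.LatticeModels.Site 4),
      v ∈ box 4 S → cruxMoment Nf (reg.β k) (bareMass reg m k) S f v s ≤ C * (1 + |reg.β k|) ^ p := by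
  obtain ⟨s, C, p, hs0, hs1, hC, h⟩ := cruxMoment_apriori_of_localCofactorDomination hK Nf
  exact ⟨s, C, p, hs0, hs1, hC, fun k S f v hv => h (reg.β k) (bareMass reg m k) S f v hv⟩


/-- Registered sub-goal form of `cruxMoment_apriori_of_localCofactorDomination` (binder-free header).
[cite: AizenmanEtAl2001, Lemma 4] -/
theorem cruxMoment_apriori :
    LocalCofactorDomination → ∀ Nf : ℕ, ∃ s C p : ℝ, 0 < s ∧ s < 1 ∧ 0 ≤ C ∧
      ∀ (β : ℝ) (mq : Fin Nf → ℝ) (S : ℕ) (f : Fin Nf) (v : Literature.Probability.LatticeModels.Site 4),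
        v ∈ box 4 S → cruxMoment Nf β mq S f v s ≤ C * (1 + |β|) ^ p :=
  fun hK Nf => cruxMoment_apriori_of_localCofactorDomination hK Nf

end Summit.QuantumFields.QCD.Theorems.VonMisesCirclesC2
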